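import Literature.MathematicalPhysics.QuantumFieldTheory.Balaban1985CMP102.Binders
import Summits.QuantumFields.Balaban3D.Proofs.Cumulant59
import Summits.QuantumFields.Balaban3D.Proofs.Bound25Sums
import Summits.QuantumFields.Balaban3D.Proofs.Eq324Chi
import Literature.MathematicalPhysics.QuantumFieldTheory.Balaban1983to89.B10Assembly

/-!
# `Balaban3D.Proofs.Run3Cumulant` — the p5 leaves CONSUMING THE SPINE BINDERS BY NAME: G3D-02
# `Binders.GraphRep23AsCited` (typer-2) + row (25) `B10.Bound25Printed` on its `GraphTerms.activities` + row B1-324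
# `Eq324`, on LQB's 3-torus block carrier — the shape in which `run3`/`pieces3` (p1) instantiates rows C3, C4, B21

Lane «pub-balaban3d», seat p5; LEAF-LEDGER rows C3 (`cumulant58`), C4 (`cumulantLower`), B21 (`PprT_le`).  Kernel glue
only (each theorem is ONE application of `Cumulant59.cumulant58_torus` / `cumulantLower_torus` / `Bound25Sums.pprT_le_torus`
with the graph binder's regrouping `GraphRep23AsCited.cum_eq_sum_activities` as the graph-representation hypothesis);
no definition, no named fact.  The `DecidableEq` instance on the torus domains is a PARAMETER (p1 supplies the one its
`pieces3` definitions use, so the `PprU`/`PprT` equations are `rfl` on its side).  What remains for p1's `pieces3 S 𝔇 k` after these: the DEFINITIONS `logFl := log ∫χe^𝒱dμ`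
(D-p5-2), `PprU :=` the retained part of `Σ_X (G h).activities.act X U` ((59); R-PIECES (d)), `PprT := Σ_X G₁.activities.act X 1`
((62)), the block count of Z_k, `N³ ≤ |T₁^{(k)}|`, and the arithmetic `hlarge` (LQB `B10Assembly.largeLoc_le_rpow`, p3).

THE PRINTED TEXT: [B10] p. 262 L1–28 + (23)–(25) (render p008), p. 270 L26–37 + (58)–(59) (render p016), [B1] (3.24)
p. 616 (render cmp85 p014) — quoted in full in `Cumulant324.lean`, `Cumulant59.lean` and in the binder G3D-02.
NON-VACUITY (the standard of LQB `B10Assembly` §5): `cumulant58_of_graphRep23_inhabited` — on LQB's trivial run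
`B10Assembly.trivRun K` / `trivPieces K k` with the EMPTY family of graph expressions (no terms: `Γ := Empty`) every
hypothesis of `cumulant58_of_graphRep23` is satisfied (all constants 0), so the hypothesis list is jointly satisfiable as
typed and the theorem is not vacuous.
[cite: Balaban1985UV3, (23)–(25) p.262 + (58)–(59) p.270]
-/

open MeasureTheory
open scoped BigOperators Nat
namespace Summit.QuantumFields.Balaban3D.Proofs

open Literature.MathematicalPhysics.QuantumFieldTheory.Balaban1983to89
open Literature.MathematicalPhysics.QuantumFieldTheory.Balaban1983to89.B10 (TowerRun)
open Literature.MathematicalPhysics.QuantumFieldTheory.Balaban1983to89.B10SectAGathering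
  (StepPieces Cumulant58 CumulantLower)
open Literature.MathematicalPhysics.QuantumFieldTheory.Balaban1983to89.B1Sect3Statements (Eq324)
open Literature.MathematicalPhysics.QuantumFieldTheory.Balaban1983to89.B12TreeDecay (kappa₀ K₀)
open Literature.MathematicalPhysics.QuantumFieldTheory.Balaban1983to89.TreeLengthTorus (tsys tcubeSys)
open Literature.MathematicalPhysics.QuantumFieldTheory.Balaban1985CMP102.Binders (GraphTerms GraphRep23AsCited)

variable {T : TowerRun} {k : ℕ} {C : ℝ} {κ : ℝ}

/-- **Row C3 `cumulant58` in filing shape.**  Per level-(k+1) history `h`: the graph-labelled expressions `G h :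
GraphTerms (tsys 3 N) (T.Cfg (k+1))` of the step's sixth-order calculation (binder G3D-02 carrier; N = big blocks of
T₁^{(k)} per direction), the binder `GraphRep23AsCited (G h) (U ↦ Σ_{n≤n̄} cum h U n/n!) C₂₃ c M₁ δ₀` (p. 262 prose + (23)),
row (25) for its activities at coupling g_k (`Bound25Printed (G h).activities (g k) κ C`, `κ ≥ κ₀(32,6) + 1`), row B1-324
`Eq324` for `lhs h U = ⟨χ e^𝒱⟩` with error `C₂·s^κ'·vol ≤ C₂·rem`, the (58)-reading of `P.logFl`, (59) as the definition
of `P.PprU` (retained activities: blocks inside Ω_{k+1}(h), 𝓛 < R), the block count of Z_k and the booked large-domain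
factor ⇒ `Cumulant58 P (C·K₀(32,6)) (C₀ + C₁ + C₂)`. [cite: Balaban1985UV3, (24) p.262 + (58)–(59) p.270] -/
theorem cumulant58_of_graphRep23 (N : ℕ) [NeZero N] [DecidableEq (tsys 3 N).Dom] (P : StepPieces T k)
    (hκ : kappa₀ (4 * 2 ^ 3) (2 * 3) + 1 ≤ κ)
    (G : T.Hist (k + 1) → GraphTerms (tsys 3 N) (T.Cfg (k + 1))) {C₂₃ c M₁ δ₀ : ℝ}
    (lhs : T.Hist (k + 1) → T.Cfg (k + 1) → ℝ) (cum : T.Hist (k + 1) → T.Cfg (k + 1) → ℕ → ℝ) {nbar : ℕ}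
    (Ωb : T.Hist (k + 1) → Finset (tcubeSys 3 N).Cube) {C₀ C₁ C₂ R s κ' vol : ℝ}
    (hG : ∀ h : T.Hist (k + 1),
      GraphRep23AsCited (G h) (fun U => ∑ n ∈ Finset.Icc 1 nbar, cum h U n / (n ! : ℝ)) C₂₃ c M₁ δ₀)
    (h25 : ∀ h : T.Hist (k + 1), B10.Bound25Printed (G h).activities (T.g k) κ C)
    (hFl : ∀ (h : T.Hist (k + 1)) (U : T.Cfg (k + 1)), P.logFl h U ≤ Real.log (lhs h U) + C₀ * P.rem)
    (h324 : ∀ (h : T.Hist (k + 1)) (U : T.Cfg (k + 1)), Eq324 (lhs h U) (cum h U) nbar C₂ s κ' vol)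
    (hC₂ : 0 ≤ C₂) (hrem : s ^ κ' * vol ≤ P.rem) (hR : 0 ≤ R) (hCg : 0 ≤ C * T.g k)
    (hPprU : ∀ (h : T.Hist (k + 1)) (U : T.Cfg (k + 1)), P.PprU h U =
      ∑ X ∈ (Finset.univ.filter (fun X : (tsys 3 N).Dom => (tcubeSys 3 N).cubes X ⊆ Ωb h)).filter
        (fun X => (tsys 3 N).dj X < R), (G h).activities.act X U)
    (hZ : ∀ h : T.Hist (k + 1), (((Finset.univ : Finset (tcubeSys 3 N).Cube) \ Ωb h).card : ℝ) ≤ P.Zvol h)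
    (hlarge : (C * T.g k * K₀ (4 * 2 ^ 3) (2 * 3) * (N : ℝ) ^ 3) * Real.exp (-R) ≤ C₁ * P.rem) :
    Cumulant58 P (C * K₀ (4 * 2 ^ 3) (2 * 3)) (C₀ + C₁ + C₂) :=
  cumulant58_torus N P hκ lhs cum (fun h X U => (G h).activities.act X U) Ωb hFl h324 hC₂ hrem hR hCg
    (fun h => h25 h) (fun h U => (hG h).cum_eq_sum_activities U) hPprU hZ hlarge

/-- **Row C4 `cumulantLower` in filing shape** — as `cumulant58_of_graphRep23`, lower direction at the trivial history
(`Eq324` and the (58)-reading only there). [cite: Balaban1985UV3, (37) p.265 + p.272 + (59) p.270] -/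
theorem cumulantLower_of_graphRep23 (N : ℕ) [NeZero N] [DecidableEq (tsys 3 N).Dom] (P : StepPieces T k)
    (hκ : kappa₀ (4 * 2 ^ 3) (2 * 3) + 1 ≤ κ)
    (G : T.Hist (k + 1) → GraphTerms (tsys 3 N) (T.Cfg (k + 1))) {C₂₃ c M₁ δ₀ : ℝ}
    (lhs : T.Hist (k + 1) → T.Cfg (k + 1) → ℝ) (cum : T.Hist (k + 1) → T.Cfg (k + 1) → ℕ → ℝ) {nbar : ℕ}
    (Ωb : T.Hist (k + 1) → Finset (tcubeSys 3 N).Cube) {C₀ C₁ C₂ R s κ' vol : ℝ}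
    (hG : ∀ h : T.Hist (k + 1),
      GraphRep23AsCited (G h) (fun U => ∑ n ∈ Finset.Icc 1 nbar, cum h U n / (n ! : ℝ)) C₂₃ c M₁ δ₀)
    (h25 : ∀ h : T.Hist (k + 1), B10.Bound25Printed (G h).activities (T.g k) κ C)
    (hFl : ∀ U : T.Cfg (k + 1),
      Real.log (lhs (T.triv (k + 1)) U) - C₀ * P.rem ≤ P.logFl (T.triv (k + 1)) U)
    (h324 : ∀ U : T.Cfg (k + 1), Eq324 (lhs (T.triv (k + 1)) U) (cum (T.triv (k + 1)) U) nbar C₂ s κ' vol)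
    (hC₂ : 0 ≤ C₂) (hrem : s ^ κ' * vol ≤ P.rem) (hR : 0 ≤ R) (hCg : 0 ≤ C * T.g k)
    (hPprU : ∀ (h : T.Hist (k + 1)) (U : T.Cfg (k + 1)), P.PprU h U =
      ∑ X ∈ (Finset.univ.filter (fun X : (tsys 3 N).Dom => (tcubeSys 3 N).cubes X ⊆ Ωb h)).filter
        (fun X => (tsys 3 N).dj X < R), (G h).activities.act X U)
    (hZ : ∀ h : T.Hist (k + 1), (((Finset.univ : Finset (tcubeSys 3 N).Cube) \ Ωb h).card : ℝ) ≤ P.Zvol h)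
    (hlarge : (C * T.g k * K₀ (4 * 2 ^ 3) (2 * 3) * (N : ℝ) ^ 3) * Real.exp (-R) ≤ C₁ * P.rem) :
    CumulantLower P (C₀ + C₁ + C₂) :=
  cumulantLower_torus N P hκ lhs cum (fun h X U => (G h).activities.act X U) Ωb hFl h324 hC₂ hrem hR hCg
    (fun h => h25 h) (fun h U => (hG h).cum_eq_sum_activities U) hPprU hZ hlarge

/-- **Row B21 `PprT_le` in filing shape**: the whole-lattice vacuum expressions `G₁ : GraphTerms (tsys 3 N) (T.Cfg (k+1))`
(the sum Σ_X 𝒫′_{k+1}(g_k, X, 1) of (62), evaluated at the unit configuration `U₁`), row (25) for `G₁.activities` at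
coupling `g_k ≤ 1` with `κ ≥ κ₀(32,6)`, `PprT := Σ_X G₁.activities.act X U₁` and `N³ ≤ |T₁^{(k)}|` ⇒
`|P.PprT| ≤ (C·K₀(32,6))·|T₁^{(k)}|` (aP := C·K₀(32,6)). [cite: Balaban1985UV3, (62) p.271 + p.273] -/
theorem pprT_le_of_graphTerms (N : ℕ) [NeZero N] [DecidableEq (tsys 3 N).Dom] (P : StepPieces T k)
    (hκ : kappa₀ (4 * 2 ^ 3) (2 * 3) ≤ κ)
    (G₁ : GraphTerms (tsys 3 N) (T.Cfg (k + 1))) (U₁ : T.Cfg (k + 1)) (hC : 0 ≤ C) (hg : 0 ≤ T.g k)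
    (hg1 : T.g k ≤ 1) (h25 : B10.Bound25Printed G₁.activities (T.g k) κ C)
    (hPprT : P.PprT = ∑ X : (tsys 3 N).Dom, G₁.activities.act X U₁) (hblocks : ((N : ℝ) ^ 3) ≤ T.sites k) :
    |P.PprT| ≤ (C * K₀ (4 * 2 ^ 3) (2 * 3)) * T.sites k :=
  pprT_le_torus N P hκ (fun X U => G₁.activities.act X U) U₁ hC hg hg1 h25 hPprT hblocks

/-- **Row C3, variant with the activities presented separately** (lane coherence G3D-01/G3D-02): the SAME printed
terms 𝒫′_{k+1}(g_k, X, U) appear twice in the expansion data — as fiberwise sums of the graph expressions (G3D-02,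
needed for (24)) and as the real parts of the chart functions of (28)–(30) (G3D-01; p6's `bound25_real_of_chart` proves
(25) for THAT presentation).  This variant takes any activity family `a` with the identification
`hact : (G h).activities.act X U = a h X U` (a DEFINITION-LEVEL fact about 𝔇, p1) and (25) stated for `a`, so p6's
derived (25) feeds the cumulant leaf directly. [cite: Balaban1985UV3, (24)–(25) p.262 + (58)–(59) p.270] -/
theorem cumulant58_of_graphRep23' (N : ℕ) [NeZero N] [DecidableEq (tsys 3 N).Dom] (P : StepPieces T k)
    (hκ : kappa₀ (4 * 2 ^ 3) (2 * 3) + 1 ≤ κ)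
    (G : T.Hist (k + 1) → GraphTerms (tsys 3 N) (T.Cfg (k + 1))) {C₂₃ c M₁ δ₀ : ℝ}
    (a : T.Hist (k + 1) → (tsys 3 N).Dom → T.Cfg (k + 1) → ℝ)
    (hact : ∀ (h : T.Hist (k + 1)) (X : (tsys 3 N).Dom) (U : T.Cfg (k + 1)), (G h).activities.act X U = a h X U)
    (lhs : T.Hist (k + 1) → T.Cfg (k + 1) → ℝ) (cum : T.Hist (k + 1) → T.Cfg (k + 1) → ℕ → ℝ) {nbar : ℕ}
    (Ωb : T.Hist (k + 1) → Finset (tcubeSys 3 N).Cube) {C₀ C₁ C₂ R s κ' vol : ℝ}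
    (hG : ∀ h : T.Hist (k + 1),
      GraphRep23AsCited (G h) (fun U => ∑ n ∈ Finset.Icc 1 nbar, cum h U n / (n ! : ℝ)) C₂₃ c M₁ δ₀)
    (h25 : ∀ h : T.Hist (k + 1),
      B10.Bound25Printed ⟨(tsys 3 N).Dom, T.Cfg (k + 1), (tsys 3 N).dj, a h⟩ (T.g k) κ C)
    (hFl : ∀ (h : T.Hist (k + 1)) (U : T.Cfg (k + 1)), P.logFl h U ≤ Real.log (lhs h U) + C₀ * P.rem)
    (h324 : ∀ (h : T.Hist (k + 1)) (U : T.Cfg (k + 1)), Eq324 (lhs h U) (cum h U) nbar C₂ s κ' vol)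
    (hC₂ : 0 ≤ C₂) (hrem : s ^ κ' * vol ≤ P.rem) (hR : 0 ≤ R) (hCg : 0 ≤ C * T.g k)
    (hPprU : ∀ (h : T.Hist (k + 1)) (U : T.Cfg (k + 1)), P.PprU h U =
      ∑ X ∈ (Finset.univ.filter (fun X : (tsys 3 N).Dom => (tcubeSys 3 N).cubes X ⊆ Ωb h)).filter
        (fun X => (tsys 3 N).dj X < R), a h X U)
    (hZ : ∀ h : T.Hist (k + 1), (((Finset.univ : Finset (tcubeSys 3 N).Cube) \ Ωb h).card : ℝ) ≤ P.Zvol h)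
    (hlarge : (C * T.g k * K₀ (4 * 2 ^ 3) (2 * 3) * (N : ℝ) ^ 3) * Real.exp (-R) ≤ C₁ * P.rem) :
    Cumulant58 P (C * K₀ (4 * 2 ^ 3) (2 * 3)) (C₀ + C₁ + C₂) :=
  cumulant58_torus N P hκ lhs cum a Ωb hFl h324 hC₂ hrem hR hCg h25
    (fun h U => by rw [(hG h).cum_eq_sum_activities U]; exact Finset.sum_congr rfl fun X _ => hact h X U)
    hPprU hZ hlarge

/-! ## R-FL / R-324 shape: `logFl := log ∫_O e^{𝒱} dμ^{(k)}` and (3.24) as the theorem `eq324_indicator` -/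

section RFL

open Literature.MathematicalPhysics.QuantumFieldTheory.Balaban1983to89.B10Eq24Cumulant (chiMeasure truncExp)

/-- **Row C3 in the lane's final shape (rulings R-FL, R-324, R-ACT).**  Expansion data per history `h` and field `U`:
the fluctuation variables `Ω h` (a topological measurable space: the A-variables on B(Λ_{k+1})), the normalised Gaussian
`μ h U` (probability, positive on open sets), the small-field box `O h` (open, nonempty) and the potential `𝒱 h U`
(a.e.-measurable, `|𝒱| ≤ B` on the box); the DEFINED piece `logFl h U = log ∫_{O h} e^{𝒱 h U} dμ h U` (`hlogFl`, rfl for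
p1's `pieces3`); the three [B1] (3.24) inputs (a) `|log μ(O)| ≤ Ca·s^κ'·vol` (small-field volume), (b) re-expansion of
the printed cumulants `cum h U` about those of the box-restricted law, (c) the cumulant-remainder bound — END hypotheses
BY NAME (R-BIND «the named inputs of eq324_of_truncated_bound»); the graph binder G3D-02 with its identification `hact`
to the lane's ONE activity family `a` (R-ACT), (25) for `a` (a THEOREM at run3: p6 `bound25_real_of_chart`), the (59)
definition of `PprU`, the block count of Z_k, the large-domain booking.  Conclusion `Cumulant58 P (C·K₀(32,6))
(0 + C₁ + (Ca + Cb + Cc))` — composition of `eq324_indicator` (this seat) with `cumulant58_of_graphRep23'`.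
[cite: Balaban1985UV3, (24) p.262 + (58)–(59) p.270; Balaban1982Higgs1, (3.24) p.616] -/
theorem cumulant58_of_graphRep23_gaussian (N : ℕ) [NeZero N] [DecidableEq (tsys 3 N).Dom] (P : StepPieces T k)
    (hκ : kappa₀ (4 * 2 ^ 3) (2 * 3) + 1 ≤ κ)
    (G : T.Hist (k + 1) → GraphTerms (tsys 3 N) (T.Cfg (k + 1))) {C₂₃ c M₁ δ₀ : ℝ}
    (a : T.Hist (k + 1) → (tsys 3 N).Dom → T.Cfg (k + 1) → ℝ)
    (hact : ∀ (h : T.Hist (k + 1)) (X : (tsys 3 N).Dom) (U : T.Cfg (k + 1)), (G h).activities.act X U = a h X U)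
    -- the fluctuation measure data (R-FL (i))
    (Ω : T.Hist (k + 1) → Type) [∀ h, TopologicalSpace (Ω h)] [∀ h, MeasurableSpace (Ω h)]
    [∀ h, OpensMeasurableSpace (Ω h)] (μ : (h : T.Hist (k + 1)) → T.Cfg (k + 1) → Measure (Ω h))
    [∀ h U, IsProbabilityMeasure (μ h U)] [∀ h U, (μ h U).IsOpenPosMeasure]
    (O : (h : T.Hist (k + 1)) → Set (Ω h)) (hO : ∀ h, IsOpen (O h)) (hOne : ∀ h, (O h).Nonempty)
    (𝒱 : (h : T.Hist (k + 1)) → T.Cfg (k + 1) → Ω h → ℝ) (hVm : ∀ h U, AEMeasurable (𝒱 h U) (μ h U)) {B : ℝ}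
    (hVB : ∀ h U, ∀ ω ∈ O h, |𝒱 h U ω| ≤ B)
    -- the defined piece (R-FL (ii))
    (hlogFl : ∀ (h : T.Hist (k + 1)) (U : T.Cfg (k + 1)),
      P.logFl h U = Real.log (∫ ω in O h, Real.exp (𝒱 h U ω) ∂μ h U))
    -- the three (3.24) inputs, END hypotheses by name
    (cum : T.Hist (k + 1) → T.Cfg (k + 1) → ℕ → ℝ) {nbar : ℕ} {Ca Cb Cc C₁ R s κ' vol : ℝ}
    (h324a : ∀ (h : T.Hist (k + 1)) (U : T.Cfg (k + 1)), |Real.log ((μ h U).real (O h))| ≤ Ca * s ^ κ' * vol)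
    (h324b : ∀ (h : T.Hist (k + 1)) (U : T.Cfg (k + 1)), |∑ n ∈ Finset.Icc 1 nbar,
        (cum h U n - truncExp (𝒱 h U) (chiMeasure (μ h U) ((O h).indicator fun _ => (1 : ℝ))) n) / (n ! : ℝ)|
          ≤ Cb * s ^ κ' * vol)
    (h324c : ∀ (h : T.Hist (k + 1)) (U : T.Cfg (k + 1)), ∀ t ∈ Set.Icc (0 : ℝ) 1,
      |iteratedDeriv (nbar + 1) (ProbabilityTheory.cgf (𝒱 h U)
          (chiMeasure (μ h U) ((O h).indicator fun _ => (1 : ℝ)))) t| ≤ Cc * ((nbar + 1)! : ℝ) * s ^ κ' * vol)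
    (hCabc : 0 ≤ Ca + Cb + Cc) (hrem : s ^ κ' * vol ≤ P.rem) (hR : 0 ≤ R) (hCg : 0 ≤ C * T.g k)
    (Ωb : T.Hist (k + 1) → Finset (tcubeSys 3 N).Cube)
    (hG : ∀ h : T.Hist (k + 1),
      GraphRep23AsCited (G h) (fun U => ∑ n ∈ Finset.Icc 1 nbar, cum h U n / (n ! : ℝ)) C₂₃ c M₁ δ₀)
    (h25 : ∀ h : T.Hist (k + 1),
      B10.Bound25Printed ⟨(tsys 3 N).Dom, T.Cfg (k + 1), (tsys 3 N).dj, a h⟩ (T.g k) κ C)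
    (hPprU : ∀ (h : T.Hist (k + 1)) (U : T.Cfg (k + 1)), P.PprU h U =
      ∑ X ∈ (Finset.univ.filter (fun X : (tsys 3 N).Dom => (tcubeSys 3 N).cubes X ⊆ Ωb h)).filter
        (fun X => (tsys 3 N).dj X < R), a h X U)
    (hZ : ∀ h : T.Hist (k + 1), (((Finset.univ : Finset (tcubeSys 3 N).Cube) \ Ωb h).card : ℝ) ≤ P.Zvol h)
    (hlarge : (C * T.g k * K₀ (4 * 2 ^ 3) (2 * 3) * (N : ℝ) ^ 3) * Real.exp (-R) ≤ C₁ * P.rem) :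
    Cumulant58 P (C * K₀ (4 * 2 ^ 3) (2 * 3)) (0 + C₁ + (Ca + Cb + Cc)) :=
  cumulant58_of_graphRep23' N P hκ G a hact (fun h U => ∫ ω in O h, Real.exp (𝒱 h U ω) ∂μ h U) cum Ωb hG h25
    (fun h U => by rw [hlogFl h U, zero_mul, add_zero])
    (fun h U => eq324_indicator (μ h U) (hO h) (hOne h) (hVm h U) (hVB h U) nbar (cum h U)
      (h324a h U) (h324b h U) (h324c h U))
    hCabc hrem hR hCg hPprU hZ hlarge

/-- **Row C4 in the lane's final shape** — the lower direction at the trivial history, same data as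
`cumulant58_of_graphRep23_gaussian` (the three (3.24) inputs and `hlogFl` are needed at `T.triv (k+1)` only).
Conclusion `CumulantLower P (0 + C₁ + (Ca + Cb + Cc))`. [cite: Balaban1985UV3, (37) p.265 + p.272 + (59) p.270] -/
theorem cumulantLower_of_graphRep23_gaussian (N : ℕ) [NeZero N] [DecidableEq (tsys 3 N).Dom] (P : StepPieces T k)
    (hκ : kappa₀ (4 * 2 ^ 3) (2 * 3) + 1 ≤ κ)
    (G : T.Hist (k + 1) → GraphTerms (tsys 3 N) (T.Cfg (k + 1))) {C₂₃ c M₁ δ₀ : ℝ}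
    (a : T.Hist (k + 1) → (tsys 3 N).Dom → T.Cfg (k + 1) → ℝ)
    (hact : ∀ (h : T.Hist (k + 1)) (X : (tsys 3 N).Dom) (U : T.Cfg (k + 1)), (G h).activities.act X U = a h X U)
    (Ω : T.Hist (k + 1) → Type) [∀ h, TopologicalSpace (Ω h)] [∀ h, MeasurableSpace (Ω h)]
    [∀ h, OpensMeasurableSpace (Ω h)] (μ : (h : T.Hist (k + 1)) → T.Cfg (k + 1) → Measure (Ω h))
    [∀ h U, IsProbabilityMeasure (μ h U)] [∀ h U, (μ h U).IsOpenPosMeasure]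
    (O : (h : T.Hist (k + 1)) → Set (Ω h)) (hO : ∀ h, IsOpen (O h)) (hOne : ∀ h, (O h).Nonempty)
    (𝒱 : (h : T.Hist (k + 1)) → T.Cfg (k + 1) → Ω h → ℝ) (hVm : ∀ h U, AEMeasurable (𝒱 h U) (μ h U)) {B : ℝ}
    (hVB : ∀ h U, ∀ ω ∈ O h, |𝒱 h U ω| ≤ B)
    (hlogFl : ∀ (h : T.Hist (k + 1)) (U : T.Cfg (k + 1)),
      P.logFl h U = Real.log (∫ ω in O h, Real.exp (𝒱 h U ω) ∂μ h U))
    (cum : T.Hist (k + 1) → T.Cfg (k + 1) → ℕ → ℝ) {nbar : ℕ} {Ca Cb Cc C₁ R s κ' vol : ℝ}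
    (h324a : ∀ (h : T.Hist (k + 1)) (U : T.Cfg (k + 1)), |Real.log ((μ h U).real (O h))| ≤ Ca * s ^ κ' * vol)
    (h324b : ∀ (h : T.Hist (k + 1)) (U : T.Cfg (k + 1)), |∑ n ∈ Finset.Icc 1 nbar,
        (cum h U n - truncExp (𝒱 h U) (chiMeasure (μ h U) ((O h).indicator fun _ => (1 : ℝ))) n) / (n ! : ℝ)|
          ≤ Cb * s ^ κ' * vol)
    (h324c : ∀ (h : T.Hist (k + 1)) (U : T.Cfg (k + 1)), ∀ t ∈ Set.Icc (0 : ℝ) 1,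
      |iteratedDeriv (nbar + 1) (ProbabilityTheory.cgf (𝒱 h U)
          (chiMeasure (μ h U) ((O h).indicator fun _ => (1 : ℝ)))) t| ≤ Cc * ((nbar + 1)! : ℝ) * s ^ κ' * vol)
    (hCabc : 0 ≤ Ca + Cb + Cc) (hrem : s ^ κ' * vol ≤ P.rem) (hR : 0 ≤ R) (hCg : 0 ≤ C * T.g k)
    (Ωb : T.Hist (k + 1) → Finset (tcubeSys 3 N).Cube)
    (hG : ∀ h : T.Hist (k + 1),
      GraphRep23AsCited (G h) (fun U => ∑ n ∈ Finset.Icc 1 nbar, cum h U n / (n ! : ℝ)) C₂₃ c M₁ δ₀)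
    (h25 : ∀ h : T.Hist (k + 1),
      B10.Bound25Printed ⟨(tsys 3 N).Dom, T.Cfg (k + 1), (tsys 3 N).dj, a h⟩ (T.g k) κ C)
    (hPprU : ∀ (h : T.Hist (k + 1)) (U : T.Cfg (k + 1)), P.PprU h U =
      ∑ X ∈ (Finset.univ.filter (fun X : (tsys 3 N).Dom => (tcubeSys 3 N).cubes X ⊆ Ωb h)).filter
        (fun X => (tsys 3 N).dj X < R), a h X U)
    (hZ : ∀ h : T.Hist (k + 1), (((Finset.univ : Finset (tcubeSys 3 N).Cube) \ Ωb h).card : ℝ) ≤ P.Zvol h)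
    (hlarge : (C * T.g k * K₀ (4 * 2 ^ 3) (2 * 3) * (N : ℝ) ^ 3) * Real.exp (-R) ≤ C₁ * P.rem) :
    CumulantLower P (0 + C₁ + (Ca + Cb + Cc)) :=
  cumulantLower_torus N P hκ (fun h U => ∫ ω in O h, Real.exp (𝒱 h U ω) ∂μ h U) cum a Ωb
    (fun U => by rw [hlogFl, zero_mul, sub_zero])
    (fun U => eq324_indicator (μ _ U) (hO _) (hOne _) (hVm _ U) (hVB _ U) nbar (cum _ U)
      (h324a _ U) (h324b _ U) (h324c _ U))
    hCabc hrem hR hCg h25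
    (fun h U => by rw [(hG h).cum_eq_sum_activities U]; exact Finset.sum_congr rfl fun X _ => hact h X U)
    hPprU hZ hlarge

end RFL

/-! ## The carrier's shape (p1 `StepSeries` v1): fixed fluctuation space, measurable box of positive measure -/

section Series

open Literature.MathematicalPhysics.QuantumFieldTheory.Balaban1983to89.B10Eq24Cumulant (chiMeasure truncExp)

/-- `PprU` over ONE filter with a conjunction (p1 `StepSeries.loc`) is the two-filter retained sum of `Cumulant59`.
[folklore] -/
theorem sum_filter_and_eq {N : ℕ} [NeZero N] (Ωs : Finset (tcubeSys 3 N).Cube) (R : ℝ)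
    (f : (tsys 3 N).Dom → ℝ) :
    ∑ X ∈ Finset.univ.filter (fun X : (tsys 3 N).Dom => (tcubeSys 3 N).cubes X ⊆ Ωs ∧ (tsys 3 N).dj X < R), f X =
      ∑ X ∈ (Finset.univ.filter (fun X : (tsys 3 N).Dom => (tcubeSys 3 N).cubes X ⊆ Ωs)).filter
        (fun X => (tsys 3 N).dj X < R), f X := by
  rw [Finset.filter_filter]

/-- **Row C3 at the carrier's v1 shape** (p1 `Carriers.Series.StepSeries`, lead batch 11): ONE fluctuation space `Fl`
with the Gaussian probability measure `μ` of the step, the measurable small-field box `box h` of positive μ-measure, the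
potential `𝒱 h U` (μ-a.e.-measurable, `|𝒱| ≤ B` on the box), `logFl h U = log ∫_{box h} e^{𝒱 h U} dμ` (rfl for
`seriesPieces`), the ONE activity family `a` (:= `StepSeries.act`, R-ACT) with the G3D-02 graph carrier `G h`
identified to it (`hact`), `PprU h U = Σ_{X : blocks ⊆ Ωblk h ∧ 𝓛(X) < Rret} a h X U` (rfl for `StepSeries.PprU`), and
the END hypotheses: (3.24) inputs (a) `h324a`, (b) `h324b` (0 if `cum := truncExp …`), (c) `h324c`; G3D-02 `hG`; (25) for
`a` (`h25`, := p6 `bound25_real_of_chart`); with the block count of Z_k and the large-domain booking ⇒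
`Cumulant58 P (C·K₀(32,6)) (0 + C₁ + (Ca + Cb + Cc))`. [cite: Balaban1985UV3, (24) p.262 + (58)–(59) p.270; Balaban1982Higgs1, (3.24) p.616] -/
theorem cumulant58_series_shape (N : ℕ) [NeZero N] [DecidableEq (tsys 3 N).Dom] (P : StepPieces T k)
    (hκ : kappa₀ (4 * 2 ^ 3) (2 * 3) + 1 ≤ κ)
    (G : T.Hist (k + 1) → GraphTerms (tsys 3 N) (T.Cfg (k + 1))) {C₂₃ c M₁ δ₀ : ℝ}
    (a : T.Hist (k + 1) → (tsys 3 N).Dom → T.Cfg (k + 1) → ℝ)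
    (hact : ∀ (h : T.Hist (k + 1)) (X : (tsys 3 N).Dom) (U : T.Cfg (k + 1)), (G h).activities.act X U = a h X U)
    {Fl : Type} [MeasurableSpace Fl] (μ : Measure Fl) [IsProbabilityMeasure μ]
    (box : T.Hist (k + 1) → Set Fl) (hboxm : ∀ h, MeasurableSet (box h)) (hbox : ∀ h, μ (box h) ≠ 0)
    (𝒱 : T.Hist (k + 1) → T.Cfg (k + 1) → Fl → ℝ) (hVm : ∀ h U, AEMeasurable (𝒱 h U) μ) {B : ℝ}
    (hVB : ∀ h U, ∀ ω ∈ box h, |𝒱 h U ω| ≤ B)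
    (hlogFl : ∀ (h : T.Hist (k + 1)) (U : T.Cfg (k + 1)),
      P.logFl h U = Real.log (∫ ω in box h, Real.exp (𝒱 h U ω) ∂μ))
    (cum : T.Hist (k + 1) → T.Cfg (k + 1) → ℕ → ℝ) {nbar : ℕ} {Ca Cb Cc C₁ s κ' vol : ℝ}
    (h324a : ∀ (h : T.Hist (k + 1)) (U : T.Cfg (k + 1)), |Real.log (μ.real (box h))| ≤ Ca * s ^ κ' * vol)
    (h324b : ∀ (h : T.Hist (k + 1)) (U : T.Cfg (k + 1)), |∑ n ∈ Finset.Icc 1 nbar,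
        (cum h U n - truncExp (𝒱 h U) (chiMeasure μ ((box h).indicator fun _ => (1 : ℝ))) n) / (n ! : ℝ)|
          ≤ Cb * s ^ κ' * vol)
    (h324c : ∀ (h : T.Hist (k + 1)) (U : T.Cfg (k + 1)), ∀ t ∈ Set.Icc (0 : ℝ) 1,
      |iteratedDeriv (nbar + 1) (ProbabilityTheory.cgf (𝒱 h U)
          (chiMeasure μ ((box h).indicator fun _ => (1 : ℝ)))) t| ≤ Cc * ((nbar + 1)! : ℝ) * s ^ κ' * vol)
    (hCabc : 0 ≤ Ca + Cb + Cc) (hrem : s ^ κ' * vol ≤ P.rem) (hCg : 0 ≤ C * T.g k)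
    (Ωblk : T.Hist (k + 1) → Finset (tcubeSys 3 N).Cube) {Rret : ℝ} (hR : 0 ≤ Rret)
    (hG : ∀ h : T.Hist (k + 1),
      GraphRep23AsCited (G h) (fun U => ∑ n ∈ Finset.Icc 1 nbar, cum h U n / (n ! : ℝ)) C₂₃ c M₁ δ₀)
    (h25 : ∀ h : T.Hist (k + 1),
      B10.Bound25Printed ⟨(tsys 3 N).Dom, T.Cfg (k + 1), (tsys 3 N).dj, a h⟩ (T.g k) κ C)
    (hPprU : ∀ (h : T.Hist (k + 1)) (U : T.Cfg (k + 1)), P.PprU h U =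
      ∑ X ∈ Finset.univ.filter
        (fun X : (tsys 3 N).Dom => (tcubeSys 3 N).cubes X ⊆ Ωblk h ∧ (tsys 3 N).dj X < Rret), a h X U)
    (hZ : ∀ h : T.Hist (k + 1), (((Finset.univ : Finset (tcubeSys 3 N).Cube) \ Ωblk h).card : ℝ) ≤ P.Zvol h)
    (hlarge : (C * T.g k * K₀ (4 * 2 ^ 3) (2 * 3) * (N : ℝ) ^ 3) * Real.exp (-Rret) ≤ C₁ * P.rem) :
    Cumulant58 P (C * K₀ (4 * 2 ^ 3) (2 * 3)) (0 + C₁ + (Ca + Cb + Cc)) :=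
  cumulant58_of_graphRep23' N P hκ G a hact (fun h U => ∫ ω in box h, Real.exp (𝒱 h U ω) ∂μ) cum Ωblk hG h25
    (fun h U => by rw [hlogFl h U, zero_mul, add_zero])
    (fun h U => eq324_indicator_of_measurableSet μ (hboxm h) (hbox h) (hVm h U) (hVB h U) nbar (cum h U)
      (h324a h U) (h324b h U) (h324c h U))
    hCabc hrem hR hCg (fun h U => by rw [hPprU h U, sum_filter_and_eq]) hZ hlarge

/-- **Row C4 at the carrier's v1 shape** — lower direction at the trivial history, same data.
[cite: Balaban1985UV3, (37) p.265 + p.272 + (59) p.270] -/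
theorem cumulantLower_series_shape (N : ℕ) [NeZero N] [DecidableEq (tsys 3 N).Dom] (P : StepPieces T k)
    (hκ : kappa₀ (4 * 2 ^ 3) (2 * 3) + 1 ≤ κ)
    (G : T.Hist (k + 1) → GraphTerms (tsys 3 N) (T.Cfg (k + 1))) {C₂₃ c M₁ δ₀ : ℝ}
    (a : T.Hist (k + 1) → (tsys 3 N).Dom → T.Cfg (k + 1) → ℝ)
    (hact : ∀ (h : T.Hist (k + 1)) (X : (tsys 3 N).Dom) (U : T.Cfg (k + 1)), (G h).activities.act X U = a h X U)
    {Fl : Type} [MeasurableSpace Fl] (μ : Measure Fl) [IsProbabilityMeasure μ]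
    (box : T.Hist (k + 1) → Set Fl) (hboxm : ∀ h, MeasurableSet (box h)) (hbox : ∀ h, μ (box h) ≠ 0)
    (𝒱 : T.Hist (k + 1) → T.Cfg (k + 1) → Fl → ℝ) (hVm : ∀ h U, AEMeasurable (𝒱 h U) μ) {B : ℝ}
    (hVB : ∀ h U, ∀ ω ∈ box h, |𝒱 h U ω| ≤ B)
    (hlogFl : ∀ (h : T.Hist (k + 1)) (U : T.Cfg (k + 1)),
      P.logFl h U = Real.log (∫ ω in box h, Real.exp (𝒱 h U ω) ∂μ))
    (cum : T.Hist (k + 1) → T.Cfg (k + 1) → ℕ → ℝ) {nbar : ℕ} {Ca Cb Cc C₁ s κ' vol : ℝ}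
    (h324a : ∀ (h : T.Hist (k + 1)) (U : T.Cfg (k + 1)), |Real.log (μ.real (box h))| ≤ Ca * s ^ κ' * vol)
    (h324b : ∀ (h : T.Hist (k + 1)) (U : T.Cfg (k + 1)), |∑ n ∈ Finset.Icc 1 nbar,
        (cum h U n - truncExp (𝒱 h U) (chiMeasure μ ((box h).indicator fun _ => (1 : ℝ))) n) / (n ! : ℝ)|
          ≤ Cb * s ^ κ' * vol)
    (h324c : ∀ (h : T.Hist (k + 1)) (U : T.Cfg (k + 1)), ∀ t ∈ Set.Icc (0 : ℝ) 1,
      |iteratedDeriv (nbar + 1) (ProbabilityTheory.cgf (𝒱 h U)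
          (chiMeasure μ ((box h).indicator fun _ => (1 : ℝ)))) t| ≤ Cc * ((nbar + 1)! : ℝ) * s ^ κ' * vol)
    (hCabc : 0 ≤ Ca + Cb + Cc) (hrem : s ^ κ' * vol ≤ P.rem) (hCg : 0 ≤ C * T.g k)
    (Ωblk : T.Hist (k + 1) → Finset (tcubeSys 3 N).Cube) {Rret : ℝ} (hR : 0 ≤ Rret)
    (hG : ∀ h : T.Hist (k + 1),
      GraphRep23AsCited (G h) (fun U => ∑ n ∈ Finset.Icc 1 nbar, cum h U n / (n ! : ℝ)) C₂₃ c M₁ δ₀)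
    (h25 : ∀ h : T.Hist (k + 1),
      B10.Bound25Printed ⟨(tsys 3 N).Dom, T.Cfg (k + 1), (tsys 3 N).dj, a h⟩ (T.g k) κ C)
    (hPprU : ∀ (h : T.Hist (k + 1)) (U : T.Cfg (k + 1)), P.PprU h U =
      ∑ X ∈ Finset.univ.filter
        (fun X : (tsys 3 N).Dom => (tcubeSys 3 N).cubes X ⊆ Ωblk h ∧ (tsys 3 N).dj X < Rret), a h X U)
    (hZ : ∀ h : T.Hist (k + 1), (((Finset.univ : Finset (tcubeSys 3 N).Cube) \ Ωblk h).card : ℝ) ≤ P.Zvol h)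
    (hlarge : (C * T.g k * K₀ (4 * 2 ^ 3) (2 * 3) * (N : ℝ) ^ 3) * Real.exp (-Rret) ≤ C₁ * P.rem) :
    CumulantLower P (0 + C₁ + (Ca + Cb + Cc)) :=
  cumulantLower_torus N P hκ (fun h U => ∫ ω in box h, Real.exp (𝒱 h U ω) ∂μ) cum a Ωblk
    (fun U => by rw [hlogFl, zero_mul, sub_zero])
    (fun U => eq324_indicator_of_measurableSet μ (hboxm _) (hbox _) (hVm _ U) (hVB _ U) nbar (cum _ U)
      (h324a _ U) (h324b _ U) (h324c _ U))
    hCabc hrem hR hCg h25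
    (fun h U => by rw [(hG h).cum_eq_sum_activities U]; exact Finset.sum_congr rfl fun X _ => hact h X U)
    (fun h U => by rw [hPprU h U, sum_filter_and_eq]) hZ hlarge

end Series

/-! ## Non-vacuity witness -/

section Witness

open Literature.MathematicalPhysics.QuantumFieldTheory.Balaban1983to89.B10Assembly (trivRun trivPieces)

/-- **Non-vacuity of `cumulant58_of_graphRep23`**: on LQB's trivial run (`trivRun K`, `trivPieces K k`: all pieces 0)
with the EMPTY graph family (no sixth-order terms at all; built inline), `lhs ≡ 1`, `cum ≡ 0`, `Ωb ≡ all blocks` and all constants `0`, EVERY hypothesis holds —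
the graph binder (its sum clause is `0 = Σ_∅`), (25) (`|0| ≤ 0`), the (58)-reading (`0 ≤ log 1 + 0`), (3.24) (`r = 0`),
the (59) definition (`0 = Σ 0`), the block count (`#∅ ≤ 0`), the large-domain booking (`0 ≤ 0`) — and the leaf follows.
So the hypotheses are jointly satisfiable as typed. [folklore] -/
theorem cumulant58_of_graphRep23_inhabited (K k N : ℕ) [NeZero N] [DecidableEq (tsys 3 N).Dom] (nbar : ℕ) :
    Cumulant58 (trivPieces K k) (0 * K₀ (4 * 2 ^ 3) (2 * 3)) (0 + 0 + 0) := by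
  refine cumulant58_of_graphRep23 (κ := kappa₀ (4 * 2 ^ 3) (2 * 3) + 1) N (trivPieces K k) le_rfl
    (fun _ => { Γ := Empty, supp := ∅, E := fun e => e.elim, loc := fun e => e.elim, nv := fun e => e.elim,
                 pref := fun e => e.elim, lines := fun e => e.elim }) (C₂₃ := 0) (c := 0) (M₁ := 0) (δ₀ := 0)
    (fun _ _ => 1) (fun _ _ _ => 0) (nbar := nbar) (fun _ => Finset.univ)
    (C₀ := 0) (C₁ := 0) (C₂ := 0) (R := 0) (s := 0) (κ' := 0) (vol := 0)
    ?_ ?_ ?_ ?_ le_rfl ?_ le_rfl ?_ ?_ ?_ ?_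
  · -- the graph binder G3D-02 for the empty family
    intro h
    refine ⟨fun U => by simp, ?_, ?_, ?_⟩ <;> intro γ _ <;> exact γ.elim
  · -- (25): the activities of the empty family vanish
    intro h X U
    simp [GraphTerms.activities]
  · -- the (58)-reading: logFl = 0 ≤ log 1 + 0·rem
    intro h U
    simp [trivPieces]
  · -- (3.24) with r = 0
    intro h U
    exact ⟨0, by simp, by simp⟩
  · -- s^κ'·vol ≤ rem
    simpa using (trivPieces K k).rem_nonneg
  · -- 0 ≤ C·g_k
    simp
  · -- (59) as the definition of PprU: 0 = Σ (empty activities)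
    intro h U
    simp [trivPieces, GraphTerms.activities]
  · -- the blocks of Z_k: none (Ωb = all blocks), |Z_k| = 0
    intro h
    simp [trivPieces]
  · -- the large-domain booking with C = 0, C₁ = 0
    simp

end Witness

end Summit.QuantumFields.Balaban3D.Proofs
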